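import Summits.QuantumAdvantage.QuantumAdvantage.Theorems.ColumnBridgeA
import Summits.QuantumAdvantage.QuantumAdvantage.Theorems.NonDisperseRankA
import Summits.QuantumAdvantage.QuantumAdvantage.Theorems.BlockRankA

set_option linter.dupNamespace false
set_option linter.unusedSectionVars false

/-!
# NonDisperseBridgeA (lens 4, g29; (P6)/(P7) ⟹ (P8) of the (c0) road) — NO DISPERSING BIPARTITION ⟹ the pool matrix satisfies `hQ` of `offDiag_lowRank`

Blocker `X = AbsorptionDial.NoPerfectPolyOdd` (item 28487); decomp-qadv lens 4, g29.  Bridges the column-half objects of `ColumnBridgeA`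
(`Side₁/Side₂`, `Cx M T side`, `rowForm`) to the abstract pair law (`PairLawA/B`, `NonDisperseRankA`): reindex `Side₂ side ≃ Fin K`, identify the
dispersion count, and conclude — when NO bipartition of the pool is dispersing — that EVERY block of the symmetrised pool matrix
`Qpool M T i j = M (T i) (T j) + M (T j) (T i)` with disjoint rows and columns has rank `≤ r₀ := 8h + ⌊C(1 + L log p)⁴⌋₊` (`BlockRankA.blockRank_of_sides`),
which is LITERALLY the hypothesis `hQ` of the landed `InnerDegreeLawsK.offDiag_lowRank_finset` ((P8)).  Modulo the Bogolyubov–Ruzsa hypothesis `hBR`.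

* `Qpool`; `diffMap_reindex`, `lowPairs_reindex` (the dispersion count of `ColumnBridgeA` = the one of `PairLawA` after `Side₂ ≃ Fin K`);
* ★ `crossRank_le_of_nonDisperse` (one non-dispersing bipartition ⟹ its cross block has rank `≤ 8h + C(1+L log p)⁴`);
* ★★ `hQ_of_allNonDisperse` (all bipartitions non-dispersing ⟹ `hQ` for `Qpool` with `r₀ = 8h + ⌊C(1+L log p)⁴⌋₊`).

Supports stmt-QuantumAdvantage-28487 (record; the residual `X` is NOT claimed).
-/

open Finset Module
open Summit.QuantumAdvantage.AdviceFreeQNC0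

namespace Summit.QuantumAdvantage.QuantumAdvantage.Theorems.ColumnBridge

variable {p : ℕ} [Fact p.Prime] {n m : ℕ}

/-- the symmetrised pool matrix `(M + Mᵀ)` on the pool `T` -/
def Qpool (M : Fin n → Fin n → ZMod p) (T : Fin m ↪ Fin n) : Matrix (Fin m) (Fin m) (ZMod p) :=
  fun i j => M (T i) (T j) + M (T j) (T i)

/-- the pair-law difference map of the reindexed cross forms is the difference of the two row forms -/
theorem diffMap_reindex {ι₁ ι₂ : Type*} [Fintype ι₁] [Fintype ι₂] {K : ℕ} (C : ι₁ → ι₂ → ZMod p) (e : ι₂ ≃ Fin K)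
    (xx : (ι₁ → Bool) × (ι₁ → Bool)) (j' : Fin K) :
    PairLaw.diffMap (fun i j' => C i (e.symm j')) xx j'
      = (BilinearCubeSum.rowForm C xx.1 - BilinearCubeSum.rowForm C xx.2) (e.symm j') := by
  unfold PairLaw.diffMap BilinearCubeSum.rowForm
  simp only [Pi.sub_apply]
  rw [← sum_sub_distrib]
  refine sum_congr rfl fun i _ => ?_
  unfold PairLaw.bit
  split_ifs <;> ring

/-- the dispersion count is invariant under the reindexing `ι₂ ≃ Fin K` -/
theorem lowPairs_reindex {ι₁ ι₂ : Type*} [Fintype ι₁] [Fintype ι₂] [DecidableEq ι₁] [DecidableEq ι₂] {K : ℕ}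
    (C : ι₁ → ι₂ → ZMod p) (e : ι₂ ≃ Fin K) (w₂ : ℕ) :
    (univ.filter fun xx : (ι₁ → Bool) × (ι₁ → Bool) =>
        (univ.filter fun j' => PairLaw.diffMap (fun i j' => C i (e.symm j')) xx j' ≠ 0).card < w₂).card
      = (univ.filter fun xx : (ι₁ → Bool) × (ι₁ → Bool) =>
        (univ.filter fun j => (BilinearCubeSum.rowForm C xx.1 - BilinearCubeSum.rowForm C xx.2) j ≠ 0).card < w₂).card := by
  classical
  refine congrArg Finset.card (filter_congr fun xx _ => ?_)
  have hc : (univ.filter fun j' => PairLaw.diffMap (fun i j' => C i (e.symm j')) xx j' ≠ 0).card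
      = (univ.filter fun j => (BilinearCubeSum.rowForm C xx.1 - BilinearCubeSum.rowForm C xx.2) j ≠ 0).card := by
    refine card_equiv e.symm fun j' => ?_
    simp only [mem_filter, mem_univ, true_and]
    rw [diffMap_reindex]
  rw [hc]

/-- **one non-dispersing bipartition ⟹ its cross block has low rank** (modulo Bogolyubov–Ruzsa `hBR` with constant `C`). -/
theorem crossRank_le_of_nonDisperse (C : ℝ) (hC : 0 ≤ C)
    (hBR : ∀ (n : ℕ) (A : Finset (Fin n → ZMod p)) (α : ℝ), 0 < α → α ≤ 1 → α * (p : ℝ) ^ n ≤ A.card →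
      ∃ V : Submodule (ZMod p) (Fin n → ZMod p),
        ((n : ℝ) - finrank (ZMod p) V) ≤ C * (1 + Real.log (1 / α)) ^ 4 ∧
        ∀ v ∈ V, ∃ a₁ ∈ A, ∃ a₂ ∈ A, ∃ a₃ ∈ A, ∃ a₄ ∈ A, v = a₁ + a₂ - a₃ - a₄)
    (hp2 : 2 ≤ p) (M : Fin n → Fin n → ZMod p) (T : Fin m ↪ Fin n) (side : Fin m → Bool) (w₂ E h L : ℕ)
    (hfail : E < (univ.filter fun xx : (Side₁ side → Bool) × (Side₁ side → Bool) =>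
      (univ.filter fun j => (BilinearCubeSum.rowForm (Cx M T side) xx.1 - BilinearCubeSum.rowForm (Cx M T side) xx.2) j ≠ 0).card < w₂).card)
    (hEL : 2 * (Fintype.card (Side₂ side) * p + 1) ^ w₂ * 4 ^ Fintype.card (Side₁ side) ≤ E * p ^ L)
    (hEpos : 0 < E) (hh : 2 * p ^ 2 * (L * p) ≤ h + 1) :
    ((Matrix.of fun (i : Side₁ side) (j : Side₂ side) => Cx M T side i j).rank : ℝ) ≤ 8 * h + C * (1 + L * Real.log p) ^ 4 := by
  classical
  set K := Fintype.card (Side₂ side) with hK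
  let e : Side₂ side ≃ Fin K := Fintype.equivFin _
  let c : Side₁ side → Fin K → ZMod p := fun i j' => Cx M T side i (e.symm j')
  have hfail' : E < (univ.filter fun xx : (Side₁ side → Bool) × (Side₁ side → Bool) =>
      (univ.filter fun j' => PairLaw.diffMap c xx j' ≠ 0).card < w₂).card := by
    rw [lowPairs_reindex (Cx M T side) e w₂]
    exact hfail
  -- `E ≤ #all pairs = 4^{K₁}` ≤ the normalisation
  have hE1 : E ≤ 2 * (K * p + 1) ^ w₂ * 4 ^ Fintype.card (Side₁ side) := by
    have h1 : (univ.filter fun xx : (Side₁ side → Bool) × (Side₁ side → Bool) =>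
        (univ.filter fun j' => PairLaw.diffMap c xx j' ≠ 0).card < w₂).card ≤ 4 ^ Fintype.card (Side₁ side) := by
      refine (card_le_univ _).trans (le_of_eq ?_)
      rw [Fintype.card_prod, Fintype.card_fun, Fintype.card_bool, ← pow_add, ← two_mul, pow_mul]
      norm_num
    have h2 : 1 ≤ 2 * (K * p + 1) ^ w₂ := by
      have := Nat.one_le_pow w₂ (K * p + 1) (by omega)
      omega
    calc E ≤ 4 ^ Fintype.card (Side₁ side) := by omega
      _ = 1 * 4 ^ Fintype.card (Side₁ side) := (one_mul _).symm
      _ ≤ 2 * (K * p + 1) ^ w₂ * 4 ^ Fintype.card (Side₁ side) := Nat.mul_le_mul_right _ h2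
  have hr := PairLaw.rank_le_of_nonDisperse C hC hBR hp2 c w₂ E h L hfail' hEL hE1 hEpos hh
  have hre : (Matrix.of c).rank = (Matrix.of fun (i : Side₁ side) (j : Side₂ side) => Cx M T side i j).rank := by
    have : Matrix.of c = (Matrix.of fun (i : Side₁ side) (j : Side₂ side) => Cx M T side i j).submatrix
        (Equiv.refl _) e.symm := by
      ext i j'
      rfl
    rw [this, Matrix.rank_submatrix]
  rw [← hre]
  exact hr

/-- **NO DISPERSING BIPARTITION ⟹ `hQ` of `offDiag_lowRank` for the pool matrix.**  Per bipartition `side` either the first side is tiny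
(`|Side₁| ≤ r₀`: the cross block trivially has rank `≤ r₀`) or the non-dispersion package holds with a SIDE-DEPENDENT threshold `E side`
(`0 < E side`, `2(K₂p+1)^w₂·4^K₁ ≤ E side · p^L`, `E side < #lowpairs side`); then every block of `Qpool M T` with disjoint injective rows/columns has
rank `≤ r₀` whenever `8h + ⌊C(1 + L log p)⁴⌋₊ ≤ r₀` — LITERALLY the hypothesis `hQ` of `InnerDegreeLawsK.offDiag_lowRank_finset`. -/
theorem hQ_of_allNonDisperse (C : ℝ) (hC : 0 ≤ C)
    (hBR : ∀ (n : ℕ) (A : Finset (Fin n → ZMod p)) (α : ℝ), 0 < α → α ≤ 1 → α * (p : ℝ) ^ n ≤ A.card →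
      ∃ V : Submodule (ZMod p) (Fin n → ZMod p),
        ((n : ℝ) - finrank (ZMod p) V) ≤ C * (1 + Real.log (1 / α)) ^ 4 ∧
        ∀ v ∈ V, ∃ a₁ ∈ A, ∃ a₂ ∈ A, ∃ a₃ ∈ A, ∃ a₄ ∈ A, v = a₁ + a₂ - a₃ - a₄)
    (hp2 : 2 ≤ p) (M : Fin n → Fin n → ZMod p) (T : Fin m ↪ Fin n) (w₂ h L r₀ : ℕ) (E : (Fin m → Bool) → ℕ)
    (hr₀ : 8 * h + ⌊C * (1 + L * Real.log p) ^ 4⌋₊ ≤ r₀) (hh : 2 * p ^ 2 * (L * p) ≤ h + 1)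
    (hall : ∀ side : Fin m → Bool, Fintype.card (Side₁ side) ≤ r₀ ∨
      (0 < E side ∧ 2 * (Fintype.card (Side₂ side) * p + 1) ^ w₂ * 4 ^ Fintype.card (Side₁ side) ≤ E side * p ^ L ∧
        E side < (univ.filter fun xx : (Side₁ side → Bool) × (Side₁ side → Bool) =>
          (univ.filter fun j => (BilinearCubeSum.rowForm (Cx M T side) xx.1 - BilinearCubeSum.rowForm (Cx M T side) xx.2) j ≠ 0).card
            < w₂).card)) :
    ∀ (s : ℕ) (f g : Fin s → Fin m), Function.Injective f → Function.Injective g → (∀ a b, f a ≠ g b) →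
      ((Qpool M T).submatrix f g).rank ≤ r₀ := by
  classical
  intro s f g _ _ hfg
  refine BlockRank.blockRank_of_sides (Qpool M T) _ (fun side => ?_) s f g hfg
  -- the cross block of `Qpool` at `side` is the `Cx` block
  have hblock : (Matrix.of fun (i : {i : Fin m // side i = true}) (j : {j : Fin m // ¬ side j = true}) => Qpool M T i.1 j.1)
      = Matrix.of fun (i : Side₁ side) (j : Side₂ side) => Cx M T side i j := by
    ext i j
    rfl
  rw [hblock]
  rcases hall side with hsmall | ⟨hEpos, hEL, hfail⟩
  · exact (Matrix.rank_le_card_height _).trans hsmall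
  have hr := crossRank_le_of_nonDisperse C hC hBR hp2 M T side w₂ (E side) h L hfail hEL hEpos hh
  -- real bound ⟹ natural bound with the floor
  set ρ := (Matrix.of fun (i : Side₁ side) (j : Side₂ side) => Cx M T side i j).rank with hρ
  have hX : 0 ≤ C * (1 + L * Real.log p) ^ 4 := by
    have hlog : 0 ≤ Real.log p := Real.log_nonneg (by exact_mod_cast (le_trans (by norm_num) hp2 : 1 ≤ p))
    positivity
  by_cases hle : ρ ≤ 8 * h
  · omega
  · have hsub : ((ρ - 8 * h : ℕ) : ℝ) ≤ C * (1 + L * Real.log p) ^ 4 := by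
      rw [Nat.cast_sub (by omega)]
      push_cast
      linarith
    have := Nat.le_floor hsub
    omega

end Summit.QuantumAdvantage.QuantumAdvantage.Theorems.ColumnBridge
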